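import Mathlib.Algebra.Ring.Hom.Defs
import Mathlib.Algebra.BigOperators.Group.List.Basic
import Mathlib.Data.ZMod.Defs
import HarnessLib

/-!
# Evaluation of tableau highest-weight vectors of `Sym^d (Sym^m V)` at sums of products of linear forms

Topic `Computability/AlgebraicComplexity`; an EXECUTABLE definitions file (kernel-evaluable by
`decide +kernel`, no well-founded recursion) serving the Lean certificate checker of the GCT
multiplicity-obstruction engine (cell `pub-gct`, bundle papers/PneNP/gct-obstructions; honest
framing of that cell: rung-1 multiplicity-obstruction search for permanent versus determinant at
small `(n, m)`; no claim about VP ≠ VNP or P ≠ NP is made here or there).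

**The object.** A highest-weight vector of weight `λ ⊢ d·m` in `Sym^d (Sym^m ℂ^k)` — equivalently
(Dörfler–Ikenmeyer–Panova 2020 §5) a degree-`d` polynomial function on the space `Sym^m` of forms
of degree `m` — is indexed by a Young tableau `T` of shape `λ` containing each label
`u ∈ {0, …, d-1}` exactly `m` times: it is the image of `π v_λ`, `v_λ = v_{μ₁} ⊗ ⋯ ⊗ v_{μ_{λ₁}}`,
`v_h = e₁ ∧ ⋯ ∧ e_h` (one alternator per column of height `h = μ_c`) under symmetrisation
[DorflerIkenmeyerPanova2020, §5, proof of Prop. 5.1 (e-print arXiv:1901.04576 Prop. 18)].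
Its value at a product of linear forms `p = ℓ₁ ⋯ ℓ_m` is the signed sum
`∑_{proper ϑ} ∏_{c} det_{ϑ,c}` over *proper placements* `ϑ` (each label's `m` boxes receive the
`m` forms bijectively) of the products over the columns `c` of the `μ_c × μ_c` determinants of the
forms placed in column `c` restricted to the column's alternator coordinates
[DorflerIkenmeyerPanova2020, §5, displayed formula after "A short calculation, which for example
is done in [CIM15], shows that (5.?) equals" — e-print eq. `(eq:contractIII)`], a formula of
Cheung–Ikenmeyer–Mkrtchyan (J. Symb. Comput. 80 (2017)). By multilinearity of `p ↦ p^{⊗d}` the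
value at a SUM of products of linear forms `q = ∑_t c_t ℓ_{t,1} ⋯ ℓ_{t,m}` (the padded permanent
`z^{m-n} per_n` has `n!` such terms, the determinant `m!`) is the sum over maps
`τ : labels → terms` of `(∏_u c_{τ u}) · ∑_{proper ϑ} ∏_c det_{ϑ,c}` where label `u`'s boxes
receive the forms of term `τ u`.

**This file** defines exactly that evaluation, `TableauEval.eval`, for data given as lists over
an arbitrary commutative ring `R` (so that it runs in `ℤ`, `ℚ`, `ℂ` and `ZMod p` alike and
commutes with ring homomorphisms, `eval_map` in the companion proofs file):

* §1 signed permutations of a list (`insertions`, `permsSign`) and the Leibniz determinant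
  `ldet` of a square matrix given by rows;
* §2 the data: `Column` (the VARIABLES its alternator uses — explicit, because which coordinates
  carry the alternator depends on the Borel convention of the user: the first `h` variables
  `0, …, h-1` in [DorflerIkenmeyerPanova2020] and in the engine (then `eval` is literally the
  engine's integer normalisation `N_T = (m!)^d f_T` of the tableau covariant `f_T`), the LAST `h`
  for the upper-triangular Borel of the tree's contragredient coordinate-ring representation
  `coordRep`, `OrbitCoordinateRing.lean` — and the labels of its boxes), `Network` (number of
  labels `d`, boxes per label `m`, columns) and `Point` (a sum of products of linear forms, each
  form a dense coefficient list);
* §3 the evaluation `eval` = sum over label assignments (term, bijection) of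
  `(∏ coefficients) · ∏_columns ldet`, and the structural check `Network.check`.

Normalisation: `eval` is the INTEGER-valued normalisation of [DorflerIkenmeyerPanova2020, §5]
(no `1/m!`, `1/h!` factors); only (non)vanishing and ranks are ever used. The efficient
column-by-column dynamic programme of [DorflerIkenmeyerPanova2020, §5, eq. after "we observe
that"] is NOT here (a later file proves it equal to `eval`); `eval` is the naive sum and is meant
for kernel evaluation of small certificates and as the SPECIFICATION the fast evaluators are
measured against. Nothing in this file is a theorem about representations: that `eval` computes
`(g · F_T)(q)` for the tree's `coordRep` and that `F_T` is a `B`-semi-invariant are the business of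
the glue files. Everything here is elementary list combinatorics [folklore] around the cited
formula.

## References
* [DorflerIkenmeyerPanova2020] J. Dörfler, C. Ikenmeyer, G. Panova, *On geometric complexity
  theory: multiplicity obstructions are stronger than occurrence obstructions*, SIAM J. Appl.
  Algebra Geom. 4 (2020) = arXiv:1901.04576, §5 (proof of the computer-calculation proposition:
  highest-weight vectors `π v_λ`, evaluation as a tensor contraction `(p^{⊗d}) π v_λ`, the
  proper-placement formula and its column dynamic programme).
* [BurgisserIkenmeyer2013] P. Bürgisser, C. Ikenmeyer, *Explicit lower bounds via geometric
  complexity theory*, STOC 2013 = arXiv:1210.8368, §4 (obstruction designs / tableau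
  highest-weight vectors and their evaluation at sums of products of linear forms).
-/

namespace Literature.Computability.AlgebraicComplexity

namespace TableauEval

/-! ## §1 Signed permutations and the Leibniz determinant -/

/-- All ways of inserting `a` into the list `l`, each with the parity (`true` = odd) of the
number of elements it was moved past (insertion at position `i` has parity `i mod 2`). [folklore] -/
def insertions {α : Type*} (a : α) : List α → List (Bool × List α)
  | [] => [(false, [a])]
  | b :: l => (false, a :: b :: l) :: (insertions a l).map fun q => (!q.1, b :: q.2)

/-- All permutations of a list together with their sign relative to the given order
(`true` = odd permutation), by structural recursion: permute the tail, insert the head.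
For `l = [0, …, h-1]` this enumerates `S_h` with signs. [folklore] -/
def permsSign {α : Type*} : List α → List (Bool × List α)
  | [] => [(false, [])]
  | a :: l => (permsSign l).flatMap fun q => (insertions a q.2).map fun r => (xor q.1 r.1, r.2)

/-- The sign `±1` of a parity bit. [folklore] -/
def sgn {R : Type*} [Ring R] (odd : Bool) : R := if odd then -1 else 1

/-- Leibniz determinant `∑_π sgn π ∏_i M_{i, π i}` of a square matrix given as a list of rows
(entries read with `getD · 0`, so a ragged or non-square list still has a value). [folklore] -/
def ldet {R : Type*} [CommRing R] (M : List (List R)) : R :=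
  ((permsSign (List.range M.length)).map fun q =>
      sgn q.1 * (List.zipWith (fun row j => row.getD j 0) M q.2).prod).sum

/-! ## §2 Data: columns, tableau networks, points -/

/-- One column of a labelled Young tableau, as the engine's certificates carry it: `vars` = the
`h` coordinates its alternator `e_{vars 0} ∧ ⋯ ∧ e_{vars (h-1)}` uses (explicit — see the module
docstring for why), `labels` = the labels `∈ {0,…,d-1}` of its `h` boxes from top to bottom.
[DorflerIkenmeyerPanova2020, §5] [folklore] -/
structure Column where
  /-- the coordinates of the column alternator -/
  vars : List ℕ
  /-- the labels of the boxes, top to bottom -/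
  labels : List ℕ
  deriving DecidableEq

/-- A tableau highest-weight-vector network: `nlabels = d` labels, each occurring `perLabel = m`
times among the boxes of the columns `cols` (shape `λ` = the column heights, `λ ⊢ d·m`).
[DorflerIkenmeyerPanova2020, §5] [folklore] -/
structure Network where
  /-- number of labels `d` (the degree of the polynomial function on forms) -/
  nlabels : ℕ
  /-- boxes per label `m` (the degree of the forms) -/
  perLabel : ℕ
  /-- the columns, left to right -/
  cols : List Column
  deriving DecidableEq

/-- A point of `Sym^m`: a sum over `terms` of `coefficient · ∏ (linear forms)`, each linear form
the dense list of its coefficients on the variables `0, 1, …`. For the padded permanent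
`z^{m-n} per_n` after a linear substitution `g`: `n!` terms with coefficient `1`, the forms being
columns of `g`. [folklore] -/
structure Point (R : Type*) where
  /-- `(c_t, [ℓ_{t,0}, …, ℓ_{t,m-1}])` -/
  terms : List (R × List (List R))

/-! ## §3 The evaluation -/

section Eval

variable {R : Type*} [CommRing R]

/-- Occurrence indices of the boxes of one column among equally-labelled boxes, given the counts
so far; returns the annotated column `[(label, occurrence)]` and the updated counts. [folklore] -/
def occCol : List ℕ → List ℕ → List (ℕ × ℕ) × List ℕ
  | [], cnt => ([], cnt)
  | u :: us, cnt =>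
    let q := cnt.getD u 0
    let rest := occCol us (cnt.set u (q + 1))
    ((u, q) :: rest.1, rest.2)

/-- For every column the list `[(label, occurrence index)]` of its boxes, boxes of equal label
being numbered `0, 1, …` column by column, left to right and top to bottom (the engine's
"column-wise" box order, [DorflerIkenmeyerPanova2020, §5]). [folklore] -/
def occAux : List Column → List ℕ → List (List (ℕ × ℕ))
  | [], _ => []
  | c :: cs, cnt =>
    let r := occCol c.labels cnt
    r.1 :: occAux cs r.2

/-- The annotated columns of a network. [folklore] -/
def Network.occ (N : Network) : List (List (ℕ × ℕ)) :=
  occAux N.cols (List.replicate N.nlabels 0)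

/-- An ASSIGNMENT gives every label `u` a pair `(t, σ)`: the term `t` of the point whose `m` forms
go to the `m` boxes labelled `u`, the `q`-th such box receiving the form `σ q`. This is the linear
form sitting in box `(u, q)`. [folklore] -/
def boxForm (P : Point R) (asg : List (ℕ × List ℕ)) (u q : ℕ) : List R :=
  let a := asg.getD u (0, [])
  ((P.terms.getD a.1 (0, [])).2).getD (a.2.getD q 0) []

/-- The `h × h` matrix of a column under an assignment: rows = boxes (top to bottom), columns =
the alternator coordinates `vars`, entry = coefficient of the box's linear form on that
coordinate — the matrix whose determinant is `det_{ϑ,c}` of [DorflerIkenmeyerPanova2020, §5].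
[folklore] -/
def colMatrix (P : Point R) (asg : List (ℕ × List ℕ)) (c : Column) (ann : List (ℕ × ℕ)) :
    List (List R) :=
  ann.map fun b =>
    let f := boxForm P asg b.1 b.2
    c.vars.map fun e => f.getD e 0

/-- The product `∏_u c_{τ u}` of the coefficients of the chosen terms. [folklore] -/
def coeffProd (P : Point R) (asg : List (ℕ × List ℕ)) (d : ℕ) : R :=
  ((List.range d).map fun u => (P.terms.getD (asg.getD u (0, [])).1 (0, [])).1).prod

/-- The summand of one complete assignment: `(∏_u c_{τ u}) · ∏_c det (colMatrix c)`. [folklore] -/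
def leaf (P : Point R) (N : Network) (asg : List (ℕ × List ℕ)) : R :=
  coeffProd P asg N.nlabels *
    (List.zipWith (fun c ann => ldet (colMatrix P asg c ann)) N.cols N.occ).prod

/-- The options for one label: a term index and a bijection `boxes ↔ forms` (a permutation of
`[0, …, m-1]`). [folklore] -/
def options (P : Point R) (m : ℕ) : List (ℕ × List ℕ) :=
  (List.range P.terms.length).flatMap fun t => (permsSign (List.range m)).map fun q => (t, q.2)

/-- Sum of `leaf` over all assignments extending `asg` to the remaining labels (structural
recursion on the list of labels still to be assigned). [folklore] -/
def evalLabels (P : Point R) (N : Network) (opts : List (ℕ × List ℕ)) :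
    List ℕ → List (ℕ × List ℕ) → R
  | [], asg => leaf P N asg
  | _ :: us, asg => (opts.map fun o => evalLabels P N opts us (asg ++ [o])).sum

/-- **The evaluation of the tableau network `N` at the point `P`**: the sum over all maps
`τ : labels → terms` and all proper placements of `(∏_u c_{τ u}) ∏_c det_{ϑ,c}`
([DorflerIkenmeyerPanova2020, §5], extended multilinearly to sums of products of linear forms).
Naive — `(#terms · m!)^d` assignments — and intended for small certificates and as the
specification of faster evaluators. [folklore] -/
def eval (P : Point R) (N : Network) : R :=
  evalLabels P N (options P N.perLabel) (List.range N.nlabels) []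

end Eval

/-! ## §4 Structural checks -/

/-- Number of occurrences of `u` in a list of naturals. [folklore] -/
def countNat (u : ℕ) (l : List ℕ) : ℕ := (l.filter fun v => v = u).length

/-- All labels of a network, column by column. [folklore] -/
def Network.allLabels (N : Network) : List ℕ := N.cols.flatMap Column.labels

/-- The shape of a network read off its columns: row `i` has as many boxes as there are columns of
height `> i` (listed for `i < ` height of the first column). [folklore] -/
def Network.shape (N : Network) : List ℕ :=
  (List.range ((N.cols.map fun c => c.labels.length).foldr max 0)).map fun i =>
    (N.cols.filter fun c => i < c.labels.length).length

/-- Structural well-formedness of a network: every column's alternator has as many DISTINCT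
coordinates as the column has boxes, column heights are weakly decreasing, every label is `< d`
and occurs exactly `m` times. [folklore] -/
def Network.check (N : Network) : Bool :=
  (N.cols.all fun c => c.vars.length == c.labels.length && decide c.vars.Nodup)
  && (List.zipWith (fun c c' => decide (c'.labels.length ≤ c.labels.length)) N.cols N.cols.tail).all id
  && (N.allLabels.all fun u => u < N.nlabels)
  && ((List.range N.nlabels).all fun u => countNat u N.allLabels == N.perLabel)

/-- Structural well-formedness of a point for a network with `m` boxes per label over `k`
variables: every term has exactly `m` forms, each with exactly `k` coefficients. [folklore] -/
def Point.check {R : Type*} (P : Point R) (m k : ℕ) : Bool :=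
  P.terms.all fun t => t.2.length == m && t.2.all fun f => f.length == k

/-! ## §5 Sanity values (kernel) -/

/-- `S_3` has six signed permutations, three of them odd. [folklore] -/
example : ((permsSign [0, 1, 2]).filter fun q => q.1).length = 3 := by decide

/-- The Leibniz determinant of `[[1,2],[3,4]]` is `-2`. [folklore] -/
example : ldet [[(1 : ℤ), 2], [3, 4]] = -2 := by decide +kernel

/-- The Leibniz determinant of a `3 × 3` integer matrix. [folklore] -/
example : ldet [[(2 : ℤ), 0, 1], [1, 3, 2], [1, 1, 1]] = 0 := by decide +kernel


/-! ## §6 Column-bijection form of the evaluation (the engine's defining formula, kernel-efficient)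

The same value organised as in the engine's DEFINITION of `F̂_T` (hwv `FORMAT.md` §2;
[DorflerIkenmeyerPanova2020, §5]): a signed sum over tuples `σ = (σ_c)_c` of bijections
`boxes of column c → vars of column c` of `∏_u q̂(α_u(σ))`, where `q̂(α)` — `α!` times the
coefficient of `x^α` in the form — is computed on demand from the sum-of-products presentation as
`∑_t c_t · perm (ℓ_{t,s}[i_{s'}])_{s,s'}` for any word `i` of content `α` (polarisation). Cost
`∏_c h_c! · d · #terms · m! · m` instead of `(#terms · m!)^d · ∑_c h_c! h_c` for `eval`; the two
agree as integers (both are `F̂_T(q)`; equality is proved in the proofs file, and checked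
numerically by the certificate exporter). This is the evaluator the certificate verifier runs. -/

section EvalC

variable {R : Type*} [CommRing R]

/-- Permanent `∑_π ∏_i M_{i, π i}` of a square matrix given by rows (entries `getD · 0`).
[folklore] -/
def lperm (M : List (List R)) : R :=
  ((permsSign (List.range M.length)).map fun q =>
      (List.zipWith (fun row j => row.getD j 0) M q.2).prod).sum

/-- The scaled symmetric-tensor entry `q̂(α(i)) = α(i)! · c_{α(i)}` of the form presented by `P`
at the word `i = (i_0, …, i_{m-1})`: `∑_t c_t · perm (ℓ_{t,s}[i_{s'}])_{s,s'}`. [folklore] -/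
def symEntry (P : Point R) (idx : List ℕ) : R :=
  (P.terms.map fun t => t.1 * lperm (t.2.map fun ℓ => idx.map fun i => ℓ.getD i 0)).sum

/-- Prepend index `i` to the `u`-th list of `acc` (no-op past the end). [folklore] -/
def consAt : List (List ℕ) → ℕ → ℕ → List (List ℕ)
  | [], _, _ => []
  | l :: ls, 0, i => (i :: l) :: ls
  | l :: ls, u + 1, i => l :: consAt ls u i

/-- Record, for the boxes of one column (labels `us`) the variables (`is`) a bijection gives them.
[folklore] -/
def pushAll : List (List ℕ) → List ℕ → List ℕ → List (List ℕ)
  | acc, u :: us, i :: is => pushAll (consAt acc u i) us is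
  | acc, _, _ => acc

/-- Signed sum over the bijections of the remaining columns; at the end the product over labels of
the symmetric-tensor entries of the collected words. [folklore] -/
def evalCols (P : Point R) : List Column → List (List ℕ) → R
  | [], acc => (acc.map (symEntry P)).prod
  | c :: cs, acc =>
    ((permsSign c.vars).map fun q => sgn q.1 * evalCols P cs (pushAll acc c.labels q.2)).sum

/-- **Column-bijection evaluation** `F̂_N(P) = ∑_σ (∏_c sgn σ_c) ∏_u q̂(α_u(σ))` (hwv `FORMAT.md`
§2 verbatim, with `q̂` by polarisation from the sum-of-products presentation). Equal to `eval`.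
[folklore] -/
def evalC (P : Point R) (N : Network) : R :=
  evalCols P N.cols (List.replicate N.nlabels [])

/-- Sanity (kernel): on the toy network `1 1 / 2 2` (labels `0 0 / 1 1`) at the quadratic form
`x₀ x₁ + x₀ x₁ = 2 x₀ x₁` presented as two products, `evalC = eval = -8` (`= 8 c₂₀ c₀₂ - 2 c₁₁²`
with `c₁₁ = 2`). [folklore] -/
example :
    let P : Point ℤ := ⟨[(1, [[1, 0], [0, 1]]), (1, [[0, 1], [1, 0]])]⟩
    let N : Network := ⟨2, 2, [⟨[0, 1], [0, 1]⟩, ⟨[0, 1], [0, 1]⟩]⟩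
    evalC P N = -8 ∧ eval P N = -8 := by
  decide +kernel

end EvalC

end TableauEval

end Literature.Computability.AlgebraicComplexity
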